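import Mathlib.Data.Nat.Choose.Basic
import Mathlib.Algebra.BigOperators.Intervals
import Mathlib.Algebra.Order.BigOperators.Group.Finset
import Mathlib.Tactic
import HarnessLib

/-!
# Windows and shells of a centred truncation (CONJECTURE U, Lemma S — part 1)

Support file for the Sahi / Conjecture-P programme of route `PercNearOneGluingNoHeavy`
(`--supports stmt-CriticalPhenomena-4575`, prover prim-l12-p5 gen 28; proof note
`prim-l12-p5/U-STRUCTURE-g28.md` §1–3).  No definitions, no named facts, no sorries.

Setting (note §1–2).  Block 1 together with the buffer is described abstractly by two functions
`F₁, Mo₁ : ℕ → ℝ` on levels `0..n₁` (block weight and block moment, tree `CoreBlock`): `F₁ > 0`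
exactly on `k ≤ n₁` (and `Mo₁ = 0` beyond), `F₁` symmetric and `Mo₁` odd under `k ↦ n₁-k`.
Block 2 has `M₂` fair coins with head count `x`; the section is `K` with `2K + j = n₁ + M₂` (shift `j ≥ 0`).
The two-block sum with a weight `v` on block 2 and constant `κ` is
`T(v) = ∑_{x ≤ M₂} C(M₂,x) v(x) Φ(x)`, `Φ(x) = κ F₁(K-x) + (2x-M₂) Mo₁(K-x)` (`0` if `x > K`).
The WINDOW sums are `W(i) = ∑_{i ≤ x ≤ M₂-i} C(M₂,x) Φ(x)` (flat tilt of depth `i`).  This file proves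
LEMMA S of the note: if the TWO-LEVEL MONOTONICITY
`(Mo₁(b)+Mo₁(b+j))(F₁(b+1)+F₁(b+1+j)) ≤ (Mo₁(b+1)+Mo₁(b+1+j))(F₁(b)+F₁(b+j))` holds (tree:
`TwoLevel.tlm_of_lc2`) and `κ ≥ 0`, then `W(0) ≥ 0` implies `W(i) ≥ 0` for every `i` and hence
`T(v) ≥ 0` for every symmetric unimodal `v ≥ 0`:

* `unimodal_le` : a symmetric unimodal weight is minimal at the ends of every centred window;
* `abel_window` : `T(v) ≥ 0` from `W(i) ≥ 0 ∀ i` (peeling `v` level by level);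
* `window_succ`, `window_eq_zero`, `window_telescope` : `W(i) = shell(i) + W(i+1)`, `W(i) = 0` past
  the centre, `W(0) = W(i) + ∑_{i'<i} shell(i')`;
* `shell_eq` : the shell value is `C(M₂,i)·[κ(F₁(b)+F₁(b+j)) − (M₂−2i)(Mo₁(b)+Mo₁(b+j))]`, `b = K-i`
  (reflection `k ↦ n₁-k` on the far point); `shell_eq_zero_of_lt`, `shell_centre_nonneg`.
The single-crossing argument and LEMMA S itself are in the sequel file `…LowerTailLemmaS`.
-/

namespace Summit.CriticalPhenomena.PercolationContinuityZ3.Theorems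

namespace Shells

open Finset

/-! ### Symmetric unimodal weights and the Abel (peeling) step -/

/-- A symmetric unimodal weight is nondecreasing on the lower half: `v x ≤ v y` for `x ≤ y`, `2y ≤ M`. -/
theorem unimodal_mono (M : ℕ) (v : ℕ → ℝ) (hvuni : ∀ x, 2 * x + 2 ≤ M → v x ≤ v (x + 1))
    (x y : ℕ) (hxy : x ≤ y) (hy : 2 * y ≤ M) : v x ≤ v y := by
  induction y with
  | zero =>
    have hx : x = 0 := by omega
    subst hx
    exact le_rfl
  | succ y ih =>
    rcases Nat.lt_or_ge x (y + 1) with hlt | hge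
    · exact le_trans (ih (by omega) (by omega)) (hvuni y (by omega))
    · have hx : x = y + 1 := by omega
      subst hx
      exact le_rfl

/-- A symmetric unimodal weight is minimal at the ends of a centred window:
`v i ≤ v x` for `i ≤ x ≤ M - i`. -/
theorem unimodal_le (M : ℕ) (v : ℕ → ℝ) (hvsym : ∀ x, x ≤ M → v x = v (M - x))
    (hvuni : ∀ x, 2 * x + 2 ≤ M → v x ≤ v (x + 1)) (i x : ℕ) (hix : i ≤ x) (hxM : x ≤ M - i) :
    v i ≤ v x := by
  rcases le_or_gt (2 * x) M with hx | hx
  · exact unimodal_mono M v hvuni i x hix hx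
  · -- reflect: v x = v (M - x) with 2(M-x) ≤ M and i ≤ M - x
    have hxM' : x ≤ M := by omega
    rw [hvsym x hxM']
    exact unimodal_mono M v hvuni i (M - x) (by omega) (by omega)

/-- **Abel / peeling step.**  If every centred-window sum of `a` is nonnegative,
`∑_{i ≤ x ≤ M-i} a(x) ≥ 0` for all `i`, then `∑_{x ≤ M} a(x) v(x) ≥ 0` for every symmetric unimodal `v ≥ 0`.
(Stated for the window starting at `i`, by downward induction; use `i = 0`.) -/
theorem abel_window (M : ℕ) (a : ℕ → ℝ)
    (hW : ∀ i, 0 ≤ ∑ x ∈ range (M + 1), (if i ≤ x ∧ x ≤ M - i then a x else 0)) :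
    ∀ d i, M + 1 - 2 * i ≤ d → ∀ v : ℕ → ℝ, (∀ x, i ≤ x → x ≤ M - i → 0 ≤ v x) →
      (∀ x, x ≤ M → v x = v (M - x)) → (∀ x, 2 * x + 2 ≤ M → v x ≤ v (x + 1)) →
      0 ≤ ∑ x ∈ range (M + 1), (if i ≤ x ∧ x ≤ M - i then a x * v x else 0) := by
  intro d
  induction d with
  | zero =>
    intro i hi v _ _ _
    -- the window is empty
    have hz : ∑ x ∈ range (M + 1), (if i ≤ x ∧ x ≤ M - i then a x * v x else 0) = 0 := by
      refine sum_eq_zero fun x _ => ?_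
      rw [if_neg]
      omega
    rw [hz]
  | succ d ih =>
    intro i hi v hvpos hvsym hvuni
    rcases Nat.lt_or_ge M (2 * i) with hempty | hne
    · have hz : ∑ x ∈ range (M + 1), (if i ≤ x ∧ x ≤ M - i then a x * v x else 0) = 0 := by
        refine sum_eq_zero fun x _ => ?_
        rw [if_neg]
        omega
      rw [hz]
    · -- peel: a v = v(i) a + a (v - v i) on the window; the second lives on the inner window
      have hsplit : ∑ x ∈ range (M + 1), (if i ≤ x ∧ x ≤ M - i then a x * v x else 0) =
          v i * ∑ x ∈ range (M + 1), (if i ≤ x ∧ x ≤ M - i then a x else 0) +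
          ∑ x ∈ range (M + 1), (if i + 1 ≤ x ∧ x ≤ M - (i + 1) then a x * (v x - v i) else 0) := by
        rw [mul_sum, ← sum_add_distrib]
        refine sum_congr rfl fun x hx => ?_
        have hxM : x ≤ M := by
          have := mem_range.mp hx
          omega
        by_cases hin : i ≤ x ∧ x ≤ M - i
        · rw [if_pos hin, if_pos hin]
          by_cases hinner : i + 1 ≤ x ∧ x ≤ M - (i + 1)
          · rw [if_pos hinner]
            ring
          · rw [if_neg hinner]
            -- x = i or x = M - i : v x = v i
            have hx' : x = i ∨ x = M - i := by omega
            have hv : v x = v i := by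
              rcases hx' with h | h
              · rw [h]
              · rw [h, ← hvsym i (by omega)]
            rw [hv]
            ring
        · rw [if_neg hin, if_neg hin, if_neg (by omega)]
          ring
      rw [hsplit]
      have h1 : 0 ≤ v i * ∑ x ∈ range (M + 1), (if i ≤ x ∧ x ≤ M - i then a x else 0) :=
        mul_nonneg (hvpos i le_rfl (by omega)) (hW i)
      have h2 : 0 ≤ ∑ x ∈ range (M + 1),
          (if i + 1 ≤ x ∧ x ≤ M - (i + 1) then a x * (v x - v i) else 0) := by
        refine ih (i + 1) (by omega) (fun x => v x - v i) ?_ ?_ ?_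
        · intro x h1x h2x
          exact sub_nonneg.mpr (unimodal_le M v hvsym hvuni i x (by omega) (by omega))
        · intro x hx
          rw [hvsym x hx]
        · intro x hx
          have := hvuni x hx
          linarith
      linarith

/-! ### Windows and shells for block 2 -/

variable (M₂ K : ℕ) (κ : ℝ) (F₁ Mo₁ : ℕ → ℝ)

/-- Window recursion: `W(i) = shell(i) + W(i+1)`, where the shell consists of the points `x = i`
and `x = M₂ - i` of the window `[i, M₂-i]`. -/
theorem window_succ (Φ : ℕ → ℝ) (i : ℕ) :
    ∑ x ∈ range (M₂ + 1), (if i ≤ x ∧ x ≤ M₂ - i then (M₂.choose x : ℝ) * Φ x else 0) =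
      (∑ x ∈ range (M₂ + 1),
        (if (x = i ∨ x = M₂ - i) ∧ 2 * i ≤ M₂ then (M₂.choose x : ℝ) * Φ x else 0)) +
      ∑ x ∈ range (M₂ + 1), (if i + 1 ≤ x ∧ x ≤ M₂ - (i + 1) then (M₂.choose x : ℝ) * Φ x else 0) := by
  rw [← sum_add_distrib]
  refine sum_congr rfl fun x hx => ?_
  by_cases hin : i ≤ x ∧ x ≤ M₂ - i
  · rw [if_pos hin]
    by_cases hinner : i + 1 ≤ x ∧ x ≤ M₂ - (i + 1)
    · rw [if_pos hinner, if_neg (by omega)]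
      ring
    · rw [if_neg hinner, if_pos (by omega)]
      ring
  · rw [if_neg hin, if_neg (by omega), if_neg (by omega)]
    ring

/-- Past the centre the window is empty: `W(i) = 0` for `2i > M₂`. -/
theorem window_eq_zero (Φ : ℕ → ℝ) (i : ℕ) (hi : M₂ < 2 * i) :
    ∑ x ∈ range (M₂ + 1), (if i ≤ x ∧ x ≤ M₂ - i then (M₂.choose x : ℝ) * Φ x else 0) = 0 := by
  refine sum_eq_zero fun x _ => ?_
  rw [if_neg]
  omega

/-- Telescoping: `W(0) = W(i) + ∑_{i' < i} shell(i')`. -/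
theorem window_telescope (Φ : ℕ → ℝ) (i : ℕ) :
    ∑ x ∈ range (M₂ + 1), (if 0 ≤ x ∧ x ≤ M₂ - 0 then (M₂.choose x : ℝ) * Φ x else 0) =
      (∑ x ∈ range (M₂ + 1), (if i ≤ x ∧ x ≤ M₂ - i then (M₂.choose x : ℝ) * Φ x else 0)) +
      ∑ i' ∈ range i, ∑ x ∈ range (M₂ + 1),
        (if (x = i' ∨ x = M₂ - i') ∧ 2 * i' ≤ M₂ then (M₂.choose x : ℝ) * Φ x else 0) := by
  induction i with
  | zero => simp
  | succ i ih =>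
    have hs : ∑ i' ∈ range (i + 1), ∑ x ∈ range (M₂ + 1),
        (if (x = i' ∨ x = M₂ - i') ∧ 2 * i' ≤ M₂ then (M₂.choose x : ℝ) * Φ x else 0) =
        (∑ i' ∈ range i, ∑ x ∈ range (M₂ + 1),
          (if (x = i' ∨ x = M₂ - i') ∧ 2 * i' ≤ M₂ then (M₂.choose x : ℝ) * Φ x else 0)) +
        ∑ x ∈ range (M₂ + 1),
          (if (x = i ∨ x = M₂ - i) ∧ 2 * i ≤ M₂ then (M₂.choose x : ℝ) * Φ x else 0) :=
      sum_range_succ _ i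
    rw [hs, ih, window_succ M₂ Φ i]
    ring

/-- The value of a shell.  With `Φ(x) = κF₁(K-x) + (2x-M₂)Mo₁(K-x)` (`0` for `x > K`),
`2K + j = n₁ + M₂`, `F₁` symmetric / `Mo₁` odd under `k ↦ n₁ - k` and both supported on `k ≤ n₁`:
for `2i < M₂` and `i ≤ K`, `shell(i) = C(M₂,i)·[κ(F₁(b) + F₁(b+j)) − (M₂ − 2i)(Mo₁(b) + Mo₁(b+j))]`
with `b = K - i`. -/
theorem shell_eq (n₁ j : ℕ) (hN : 2 * K + j = n₁ + M₂)
    (hFz : ∀ k, n₁ < k → F₁ k = 0) (hMoz : ∀ k, n₁ < k → Mo₁ k = 0)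
    (hFsym : ∀ k, k ≤ n₁ → F₁ (n₁ - k) = F₁ k) (hMoodd : ∀ k, k ≤ n₁ → Mo₁ (n₁ - k) = -Mo₁ k)
    (i : ℕ) (hi : 2 * i < M₂) (hiK : i ≤ K) :
    ∑ x ∈ range (M₂ + 1),
        (if (x = i ∨ x = M₂ - i) ∧ 2 * i ≤ M₂ then (M₂.choose x : ℝ) *
          (if x ≤ K then κ * F₁ (K - x) + (2 * (x : ℝ) - M₂) * Mo₁ (K - x) else 0) else 0) =
      (M₂.choose i : ℝ) * (κ * (F₁ (K - i) + F₁ (K - i + j)) -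
        ((M₂ : ℝ) - 2 * i) * (Mo₁ (K - i) + Mo₁ (K - i + j))) := by
  rw [Finset.sum_eq_add (i) (M₂ - i) (by omega)]
  · -- the two points
    have c1 : (i = i ∨ i = M₂ - i) ∧ 2 * i ≤ M₂ := by omega
    have c2 : (M₂ - i = i ∨ M₂ - i = M₂ - i) ∧ 2 * i ≤ M₂ := by omega
    rw [if_pos c1, if_pos c2, if_pos hiK, Nat.choose_symm (show i ≤ M₂ by omega)]
    have hcast : ((M₂ - i : ℕ) : ℝ) = (M₂ : ℝ) - i := by
      push_cast [Nat.cast_sub (show i ≤ M₂ by omega)]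
      ring
    by_cases hfar : M₂ - i ≤ K
    · -- far point present: reflect k = K - (M₂ - i)
      rw [if_pos hfar]
      have hk : K - (M₂ - i) ≤ n₁ := by omega
      have e : n₁ - (K - (M₂ - i)) = K - i + j := by omega
      have hF : F₁ (K - (M₂ - i)) = F₁ (K - i + j) := by rw [← hFsym _ hk, e]
      have hMo : Mo₁ (K - (M₂ - i)) = -Mo₁ (K - i + j) := by
        have := hMoodd _ hk
        rw [e] at this
        linarith
      rw [hF, hMo, hcast]
      ring
    · -- far point absent: the reflected level exceeds n₁
      rw [if_neg hfar]
      have hbig : n₁ < K - i + j := by omega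
      rw [hFz _ hbig, hMoz _ hbig]
      ring
  · intro x _ hne
    rw [if_neg]
    intro h
    rcases h.1 with h1 | h1
    · exact hne.1 h1
    · exact hne.2 h1
  · intro h
    exfalso
    exact h (mem_range.mpr (by omega))
  · intro h
    exfalso
    exact h (mem_range.mpr (by omega))

/-- A shell with `i > K` vanishes (both of its points lie above the section). -/
theorem shell_eq_zero_of_lt (i : ℕ) (hiK : K < i) :
    ∑ x ∈ range (M₂ + 1),
        (if (x = i ∨ x = M₂ - i) ∧ 2 * i ≤ M₂ then (M₂.choose x : ℝ) *
          (if x ≤ K then κ * F₁ (K - x) + (2 * (x : ℝ) - M₂) * Mo₁ (K - x) else 0) else 0) = 0 := by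
  refine sum_eq_zero fun x _ => ?_
  by_cases h : (x = i ∨ x = M₂ - i) ∧ 2 * i ≤ M₂
  · rw [if_pos h, if_neg (by omega)]
    ring
  · rw [if_neg h]

/-- The centre shell (`2i = M₂`) is `C(M₂,i) κ F₁(K-i) ≥ 0` (or `0`). -/
theorem shell_centre_nonneg (hκ : 0 ≤ κ) (hF0 : ∀ k, 0 ≤ F₁ k) (i : ℕ) (hi : 2 * i = M₂) :
    0 ≤ ∑ x ∈ range (M₂ + 1),
        (if (x = i ∨ x = M₂ - i) ∧ 2 * i ≤ M₂ then (M₂.choose x : ℝ) *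
          (if x ≤ K then κ * F₁ (K - x) + (2 * (x : ℝ) - M₂) * Mo₁ (K - x) else 0) else 0) := by
  refine sum_nonneg fun x _ => ?_
  by_cases h : (x = i ∨ x = M₂ - i) ∧ 2 * i ≤ M₂
  · rw [if_pos h]
    have hx : x = i := by omega
    subst hx
    by_cases hxK : x ≤ K
    · rw [if_pos hxK]
      have hc : (2 * (x : ℝ) - M₂) = 0 := by
        have : ((2 * x : ℕ) : ℝ) = (M₂ : ℝ) := by exact_mod_cast hi
        push_cast at this
        linarith
      rw [hc, zero_mul, add_zero]
      exact mul_nonneg (by positivity) (mul_nonneg hκ (hF0 (K - x)))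
    · rw [if_neg hxK]
      simp
  · rw [if_neg h]

end Shells

end Summit.CriticalPhenomena.PercolationContinuityZ3.Theorems
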